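import Summits.HubbardSuperconductivity.HubbardSuperconductivity.Theorems.LiebTwinTwinOnsiteCondensationMajorantCore
import Summits.HubbardSuperconductivity.HubbardSuperconductivity.Theorems.LiebTwinTwinOnsiteCondensationMajorantTransfer
import Summits.HubbardSuperconductivity.HubbardSuperconductivity.Theorems.LiebTwinTwinOnsiteCondensationMajorantCap

/-!
# Route `LiebTwin`, crux `TwinOnsiteCondensation` (stmt-HubbardSuperconductivity-15258), line `majorant`:
# stub M1 `stub_pairCoherenceMajorant` — the pair-coherence majorant

For every side `L`, every `n`, every normalised `φ` in Lieb's `(n, n)` sector of the fermionic torus and every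
contraction kernel `G` on `ℓ²(Λ_L)`, the opposite-spin pair annihilator `O_G = Σ_{x,y} G x y • c_{y↓} c_{x↑}`
obeys `(Re⟨φ, O_Gᴴ O_G φ⟩)² ≤ κ L⁴ F_s(φ̃)` with `κ = 1`, `φ̃ = liebVec n |liebW n φ|` the twin and
`F_s(χ) = Re⟨χ, Δ_sᴴ Δ_s χ⟩` the on-site pair order. Proof (`n = m + 1`; `n = 0` is `0 ≤ F_s`): in Lieb
coordinates `⟨φ, O_Gᴴ O_G φ⟩ = ‖Φ_G‖²_F`, `Φ_G = Σ G x y • a_x W a_yᵀ` (tree, `expect_pairChannel_eq`); split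
`W = S T`, `TᴴT = |W|`, `Tr((SSᴴ)²) = Tr(WᴴW) = 1` (tree, `exists_mul_eq_conjTranspose_mul_eq_cfcAbs`); the block
Cauchy–Schwarz inequality (tree, `frobenius_block_cauchy_schwarz`, here in the block form
`sq_sum_norm_sq_block_le`) gives `‖Φ_G‖⁴_F ≤ ‖Σ_x a_x SSᴴ a_xᵀ‖²_F · ‖Σ_y a_y |W| a_yᵀ‖²_F`; the second factor
is `F_s(φ̃)/2` and the first is at most `n(L² - n + 1) ≤ L⁴` (tree, `re_expect_pairField_sWave_liebVec_eq`,
`sum_norm_sq_configPair_le` — Yang's bound).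

Sources: E. H. Lieb, PRL **62** (1989) 1201, proof of Theorem 1; C. N. Yang, Rev. Mod. Phys. **34** (1962)
694, §4; R. A. Horn, C. R. Johnson, *Matrix Analysis* (2012) §5.6, §7.3. No definition and no named fact is
introduced.
-/

-- the mandated namespace `Summit.<Summit>.<Problem>.Theorems` repeats `HubbardSuperconductivity`
-- (single-problem summit, D-0017), which the `dupNamespace` linter flags on every declaration
set_option linter.dupNamespace false

noncomputable section

namespace Summit.HubbardSuperconductivity.HubbardSuperconductivity.Theorems.LiebTwinMajorant

open Matrix Finset Literature.MathematicalPhysics.QuantumLattice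
open scoped ComplexOrder MatrixOrder Matrix.Norms.L2Operator

/-! ### The block form of the Frobenius Cauchy–Schwarz inequality -/

section Block

variable {a b ι Λ : Type*} [Fintype a] [Fintype b] [Fintype ι] [Fintype Λ]

/-- **Block form of the Frobenius Cauchy–Schwarz inequality.** For families of rectangular matrices
`X x : a × ι`, `Y y : ι × b` indexed by a finite set and a contraction kernel `G` on it:
`(Σ_{ij} |(Σ_{x,y} G x y • X_x Y_y)_{ij}|²)² ≤ (Σ |(Σ_x X_x X_xᴴ)_{ii'}|²) (Σ |(Σ_y Y_yᴴ Y_y)_{jj'}|²)`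
(`Σ G x y • X_x Y_y = 𝐏 (1 ⊗ G) 𝐐` with the block row `𝐏 = [X_x]_x` and block column `𝐐 = [Y_y]_y`,
`𝐏𝐏ᴴ = Σ X_x X_xᴴ`, `𝐐ᴴ𝐐 = Σ Y_yᴴ Y_y`, and `1 ⊗ G` is a contraction; then `frobenius_block_cauchy_schwarz`).
Horn–Johnson, Matrix Analysis (2012) §5.6. [folklore] -/
theorem sq_sum_norm_sq_block_le (X : Λ → Matrix a ι ℂ) (Y : Λ → Matrix ι b ℂ) (G : Matrix Λ Λ ℂ)
    (hG : ∀ v : Λ → ℂ, (star (G *ᵥ v) ⬝ᵥ (G *ᵥ v)).re ≤ (star v ⬝ᵥ v).re) :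
    (∑ i, ∑ j, ‖(∑ x, ∑ y, G x y • (X x * Y y)) i j‖ ^ 2) ^ 2 ≤
      (∑ i, ∑ i', ‖(∑ x, X x * (X x)ᴴ) i i'‖ ^ 2) * (∑ j, ∑ j', ‖(∑ y, (Y y)ᴴ * Y y) j j'‖ ^ 2) := by
  classical
  -- block row, block kernel, block column
  set P : Matrix a (ι × Λ) ℂ := Matrix.of fun i p => X p.2 i p.1 with hP
  set K : Matrix (ι × Λ) (ι × Λ) ℂ := Matrix.of fun p q => if p.1 = q.1 then G p.2 q.2 else 0 with hK
  set Q : Matrix (ι × Λ) b ℂ := Matrix.of fun p j => Y p.2 p.1 j with hQ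
  have hPKQ : P * K * Q = ∑ x, ∑ y, G x y • (X x * Y y) := by
    ext i j
    have hPK : ∀ q : ι × Λ, (P * K) i q = ∑ x, X x i q.1 * G x q.2 := by
      intro q
      rw [Matrix.mul_apply, Fintype.sum_prod_type, Finset.sum_comm]
      refine Finset.sum_congr rfl fun x _ => ?_
      simp only [hP, hK, Matrix.of_apply, mul_ite, mul_zero]
      rw [Finset.sum_ite_eq' univ q.1]
      simp
    rw [Matrix.mul_apply, Fintype.sum_prod_type]
    simp only [hPK, hQ, Matrix.of_apply, Matrix.sum_apply, Matrix.smul_apply, smul_eq_mul, Matrix.mul_apply,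
      Finset.sum_mul, Finset.mul_sum]
    rw [Finset.sum_comm]
    conv_rhs => rw [Finset.sum_comm]
    refine Finset.sum_congr rfl fun y _ => ?_
    rw [Finset.sum_comm]
    refine Finset.sum_congr rfl fun x _ => Finset.sum_congr rfl fun β _ => ?_
    ring
  have hPP : P * Pᴴ = ∑ x, X x * (X x)ᴴ := by
    ext i i'
    rw [Matrix.mul_apply, Fintype.sum_prod_type, Finset.sum_comm, Matrix.sum_apply]
    refine Finset.sum_congr rfl fun x _ => ?_
    rw [Matrix.mul_apply]
    simp only [hP, conjTranspose_apply, Matrix.of_apply]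
  have hQQ : Qᴴ * Q = ∑ y, (Y y)ᴴ * Y y := by
    ext j j'
    rw [Matrix.mul_apply, Fintype.sum_prod_type, Finset.sum_comm, Matrix.sum_apply]
    refine Finset.sum_congr rfl fun y _ => ?_
    rw [Matrix.mul_apply]
    simp only [hQ, conjTranspose_apply, Matrix.of_apply]
  have hKc : ∀ v : ι × Λ → ℂ, (star (K *ᵥ v) ⬝ᵥ (K *ᵥ v)).re ≤ (star v ⬝ᵥ v).re := by
    intro v
    have hKv : ∀ p : ι × Λ, (K *ᵥ v) p = (G *ᵥ fun y => v (p.1, y)) p.2 := by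
      intro p
      rw [Matrix.mulVec, dotProduct, Fintype.sum_prod_type, Matrix.mulVec, dotProduct]
      simp only [hK, Matrix.of_apply, ite_mul, zero_mul]
      rw [Finset.sum_comm]
      simp only [Finset.sum_ite_eq, Finset.mem_univ, if_true]
    have h1 : star (K *ᵥ v) ⬝ᵥ (K *ᵥ v) =
        ∑ β : ι, star (G *ᵥ fun y => v (β, y)) ⬝ᵥ (G *ᵥ fun y => v (β, y)) := by
      rw [dotProduct, Fintype.sum_prod_type]
      refine Finset.sum_congr rfl fun β _ => ?_
      rw [dotProduct]
      refine Finset.sum_congr rfl fun y _ => ?_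
      rw [Pi.star_apply, Pi.star_apply, hKv]
    have h2 : star v ⬝ᵥ v = ∑ β : ι, star (fun y => v (β, y)) ⬝ᵥ (fun y => v (β, y)) := by
      rw [dotProduct, Fintype.sum_prod_type]
      rfl
    rw [h1, h2, Complex.re_sum, Complex.re_sum]
    exact Finset.sum_le_sum fun β _ => hG _
  have key := frobenius_block_cauchy_schwarz P K Q hKc
  rwa [hPKQ, hPP, hQQ] at key

end Block

/-! ### Fock-space lemmas -/

section Fock

variable {Λ : Type*} [LinearOrder Λ] [Fintype Λ]

omit [Fintype Λ] in
/-- The entries of the spinless annihilator are real: `(c_x)ᴴ = (c_x)ᵀ`. [folklore] -/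
theorem conjTranspose_annihilation_eq_transpose (x : Λ) :
    (annihilation x : Matrix (Finset Λ) (Finset Λ) ℂ)ᴴ = (annihilation x)ᵀ := by
  ext s t
  rw [conjTranspose_apply, transpose_apply, annihilation_apply]
  split_ifs <;> simp [star_jwSign]

/-- `0 ≤ Re⟨ψ, Mᴴ M ψ⟩ = ‖Mψ‖²`. [folklore] -/
theorem re_expect_conjTranspose_mul_self_nonneg {ι : Type*} [Fintype ι] (M : Matrix (Finset ι) (Finset ι) ℂ)
    (ψ : Fock ι) : 0 ≤ (expect (Mᴴ * M) ψ).re := by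
  rw [Literature.MathematicalPhysics.QuantumLattice.expect, LiebThm1.star_dotProduct_conjTranspose_mul_mulVec]
  exact (Complex.nonneg_iff.1 (dotProduct_star_self_nonneg _)).1

/-- In the `0`-up-electron sectors the pair annihilator kills `φ`: `O_G φ = 0`. [folklore] -/
theorem pairChannel_mulVec_eq_zero {b : ℕ} {φ : Fock (Orb Λ)} (hφ : IsInSector 0 b φ) (G : Matrix Λ Λ ℂ) :
    (∑ x : Λ, ∑ y : Λ, G x y • (annihilation (orb y 1) * annihilation (orb x 0) :
        Matrix (Finset (Orb Λ)) (Finset (Orb Λ)) ℂ)) *ᵥ φ = 0 := by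
  rw [pairChannel_mulVec_eq]
  refine Finset.sum_eq_zero fun x _ => Finset.sum_eq_zero fun y _ => ?_
  rw [hφ.annihilation_up_mulVec_eq_zero x, Matrix.mulVec_zero, smul_zero]

/-- In the `0`-up-electron sectors `⟨φ, O_Gᴴ O_G φ⟩ = 0`. [folklore] -/
theorem expect_pairChannel_eq_zero {b : ℕ} {φ : Fock (Orb Λ)} (hφ : IsInSector 0 b φ) (G : Matrix Λ Λ ℂ) :
    expect ((∑ x : Λ, ∑ y : Λ, G x y • (annihilation (orb y 1) * annihilation (orb x 0) :
        Matrix (Finset (Orb Λ)) (Finset (Orb Λ)) ℂ))ᴴ *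
        (∑ x : Λ, ∑ y : Λ, G x y • (annihilation (orb y 1) * annihilation (orb x 0)))) φ = 0 := by
  rw [Literature.MathematicalPhysics.QuantumLattice.expect, LiebThm1.star_dotProduct_conjTranspose_mul_mulVec,
    pairChannel_mulVec_eq_zero hφ, dotProduct_zero]

end Fock

/-! ### The stub -/

/-- Bookkeeping: `F² ≤ PQ`, `P ≤ c ≤ X`, `0 ≤ Q` give `F² ≤ 1·X·(2Q)`. [folklore] -/
theorem sq_le_one_mul_mul_two_mul {F P Q c X : ℝ} (h1 : F ^ 2 ≤ P * Q) (h2 : P ≤ c) (h3 : c ≤ X)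
    (hQ : 0 ≤ Q) : F ^ 2 ≤ 1 * X * (2 * Q) := by
  nlinarith [mul_le_mul_of_nonneg_right (h2.trans h3) hQ]

section Torus

/-- A normalised vector of the `(n, n)` sector of the torus forces `n ≤ L²`. [folklore] -/
theorem le_sq_of_isInSector {L : ℕ} {n : ℕ} {φ : Fock (Orb (FermionTorus 2 L))} (hφ1 : star φ ⬝ᵥ φ = 1)
    (hφ : IsInSector n n φ) : n ≤ L ^ 2 := by
  have hφ0 : φ ≠ 0 := by
    rintro rfl
    rw [star_zero, zero_dotProduct] at hφ1
    exact zero_ne_one hφ1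
  have hcard : Fintype.card (FermionTorus 2 L) = L ^ 2 := by
    simp [FermionTorus, Fintype.card_lex, Fintype.card_fin]
  exact hcard ▸ (le_card_of_isInSector hφ hφ0).1

/-- **Stub M1 — the pair-coherence majorant** (`κ = 1`). For every side `L`, every `n`, every normalised
`φ` in the `(n, n)` sector and every contraction kernel `G`:
`(Re⟨φ, O_Gᴴ O_G φ⟩)² ≤ L⁴ · F_s(liebVec n |liebW n φ|)`, `O_G = Σ_{x,y} G x y • c_{y↓} c_{x↑}` (block
Cauchy–Schwarz in Lieb coordinates with the polar split `W = S T`, Yang's bound on the co-twin factor).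
Lieb, PRL 62 (1989) 1201, proof of Theorem 1; Yang, Rev. Mod. Phys. 34 (1962) 694, §4. [folklore] -/
theorem stub_pairCoherenceMajorant :
    ∃ κ : ℝ, 0 < κ ∧ ∀ (L : ℕ) [NeZero L] (n : ℕ) (φ : Fock (Orb (FermionTorus 2 L))),
      star φ ⬝ᵥ φ = 1 → IsInSector n n φ →
        ∀ G : Matrix (FermionTorus 2 L) (FermionTorus 2 L) ℂ,
          (∀ v : FermionTorus 2 L → ℂ, (star (G *ᵥ v) ⬝ᵥ (G *ᵥ v)).re ≤ (star v ⬝ᵥ v).re) →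
          (expect ((∑ x : FermionTorus 2 L, ∑ y : FermionTorus 2 L,
                G x y • (annihilation (orb y 1) * annihilation (orb x 0)))ᴴ *
              (∑ x : FermionTorus 2 L, ∑ y : FermionTorus 2 L,
                G x y • (annihilation (orb y 1) * annihilation (orb x 0)))) φ).re ^ 2 ≤
            κ * (L : ℝ) ^ 4 *
              (expect ((pairField sWave L)ᴴ * pairField sWave L)
                (liebVec n (CFC.abs (liebW n φ)))).re := by
  refine ⟨1, one_pos, ?_⟩
  intro L _ n φ hφ1 hφ G hG
  have hFs := re_expect_conjTranspose_mul_self_nonneg (pairField sWave L) (liebVec n (CFC.abs (liebW n φ)))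
  cases n with
  | zero =>
    rw [expect_pairChannel_eq_zero hφ G, Complex.zero_re, zero_pow two_ne_zero]
    positivity
  | succ m =>
    have hmL : (m : ℝ) + 1 ≤ (L : ℝ) ^ 2 := by exact_mod_cast le_sq_of_isInSector hφ1 hφ
    -- the polar split of `W = liebW (m+1) φ`
    obtain ⟨S, T, hST, hTT, htr⟩ := exists_mul_eq_conjTranspose_mul_eq_cfcAbs (liebW (m + 1) φ)
    have htr1 : (((S * Sᴴ)ᴴ * (S * Sᴴ)).trace).re = 1 := by
      rw [conjTranspose_mul, conjTranspose_conjTranspose, htr]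
      change (hsInner (liebW (m + 1) φ) (liebW (m + 1) φ)).re = 1
      rw [LiebThm1.hsInner_liebW hφ φ, hφ1, Complex.one_re]
    have hBherm : (S * Sᴴ)ᴴ = S * Sᴴ := by rw [conjTranspose_mul, conjTranspose_conjTranspose]
    -- real entries of the rectangular annihilators
    have hreal : ∀ x : FermionTorus 2 L, (
              ((annihilation x).submatrix
                  (Subtype.val : Config (FermionTorus 2 L) m → Finset (FermionTorus 2 L))
                  (Subtype.val : Config (FermionTorus 2 L) (m + 1) → Finset (FermionTorus 2 L))))ᴴ = (
              ((annihilation x).submatrix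
                  (Subtype.val : Config (FermionTorus 2 L) m → Finset (FermionTorus 2 L))
                  (Subtype.val : Config (FermionTorus 2 L) (m + 1) → Finset (FermionTorus 2 L))))ᵀ := fun x => by
      rw [conjTranspose_submatrix, transpose_submatrix, conjTranspose_annihilation_eq_transpose]
    -- block Cauchy–Schwarz with `X_x = a_x S`, `Y_y = T a_yᵀ`
    have hblock := sq_sum_norm_sq_block_le (fun x : FermionTorus 2 L =>
              ((annihilation x).submatrix
                  (Subtype.val : Config (FermionTorus 2 L) m → Finset (FermionTorus 2 L))
                  (Subtype.val : Config (FermionTorus 2 L) (m + 1) → Finset (FermionTorus 2 L))) * S) (fun y : FermionTorus 2 L => T * (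
              ((annihilation y).submatrix
                  (Subtype.val : Config (FermionTorus 2 L) m → Finset (FermionTorus 2 L))
                  (Subtype.val : Config (FermionTorus 2 L) (m + 1) → Finset (FermionTorus 2 L))))ᵀ) G hG
    have hXY : (∑ x : FermionTorus 2 L, ∑ y : FermionTorus 2 L, G x y • (
              ((annihilation x).submatrix
                  (Subtype.val : Config (FermionTorus 2 L) m → Finset (FermionTorus 2 L))
                  (Subtype.val : Config (FermionTorus 2 L) (m + 1) → Finset (FermionTorus 2 L))) * S * (T * (
              ((annihilation y).submatrix
                  (Subtype.val : Config (FermionTorus 2 L) m → Finset (FermionTorus 2 L))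
                  (Subtype.val : Config (FermionTorus 2 L) (m + 1) → Finset (FermionTorus 2 L))))ᵀ))) =
        ∑ x : FermionTorus 2 L, ∑ y : FermionTorus 2 L,
          G x y • (
              ((annihilation x).submatrix
                  (Subtype.val : Config (FermionTorus 2 L) m → Finset (FermionTorus 2 L))
                  (Subtype.val : Config (FermionTorus 2 L) (m + 1) → Finset (FermionTorus 2 L))) * liebW (m + 1) φ * (
              ((annihilation y).submatrix
                  (Subtype.val : Config (FermionTorus 2 L) m → Finset (FermionTorus 2 L))
                  (Subtype.val : Config (FermionTorus 2 L) (m + 1) → Finset (FermionTorus 2 L))))ᵀ) := by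
      refine Finset.sum_congr rfl fun x _ => Finset.sum_congr rfl fun y _ => ?_
      rw [← hST]
      simp only [Matrix.mul_assoc]
    have hPP : (∑ x : FermionTorus 2 L,
              ((annihilation x).submatrix
                  (Subtype.val : Config (FermionTorus 2 L) m → Finset (FermionTorus 2 L))
                  (Subtype.val : Config (FermionTorus 2 L) (m + 1) → Finset (FermionTorus 2 L))) * S * (
              ((annihilation x).submatrix
                  (Subtype.val : Config (FermionTorus 2 L) m → Finset (FermionTorus 2 L))
                  (Subtype.val : Config (FermionTorus 2 L) (m + 1) → Finset (FermionTorus 2 L))) * S)ᴴ) =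
        ∑ x : FermionTorus 2 L,
              ((annihilation x).submatrix
                  (Subtype.val : Config (FermionTorus 2 L) m → Finset (FermionTorus 2 L))
                  (Subtype.val : Config (FermionTorus 2 L) (m + 1) → Finset (FermionTorus 2 L))) * (S * Sᴴ) * (
              ((annihilation x).submatrix
                  (Subtype.val : Config (FermionTorus 2 L) m → Finset (FermionTorus 2 L))
                  (Subtype.val : Config (FermionTorus 2 L) (m + 1) → Finset (FermionTorus 2 L))))ᵀ := by
      refine Finset.sum_congr rfl fun x _ => ?_
      rw [conjTranspose_mul, hreal]
      simp only [Matrix.mul_assoc]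
    have hQQ : (∑ y : FermionTorus 2 L, (T * (
              ((annihilation y).submatrix
                  (Subtype.val : Config (FermionTorus 2 L) m → Finset (FermionTorus 2 L))
                  (Subtype.val : Config (FermionTorus 2 L) (m + 1) → Finset (FermionTorus 2 L))))ᵀ)ᴴ * (T * (
              ((annihilation y).submatrix
                  (Subtype.val : Config (FermionTorus 2 L) m → Finset (FermionTorus 2 L))
                  (Subtype.val : Config (FermionTorus 2 L) (m + 1) → Finset (FermionTorus 2 L))))ᵀ)) =
        ∑ y : FermionTorus 2 L,
              ((annihilation y).submatrix
                  (Subtype.val : Config (FermionTorus 2 L) m → Finset (FermionTorus 2 L))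
                  (Subtype.val : Config (FermionTorus 2 L) (m + 1) → Finset (FermionTorus 2 L))) * CFC.abs (liebW (m + 1) φ) * (
              ((annihilation y).submatrix
                  (Subtype.val : Config (FermionTorus 2 L) m → Finset (FermionTorus 2 L))
                  (Subtype.val : Config (FermionTorus 2 L) (m + 1) → Finset (FermionTorus 2 L))))ᵀ := by
      refine Finset.sum_congr rfl fun y _ => ?_
      rw [conjTranspose_mul, conjTranspose_transpose_eq_transpose_conjTranspose, hreal, transpose_transpose,
        ← hTT]
      simp only [Matrix.mul_assoc]
    rw [hXY, hPP, hQQ] at hblock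
    -- Yang's cap on the co-twin factor and the pair order of the twin
    have hcap := sum_norm_sq_configPair_le L m (S * Sᴴ) hBherm
    rw [htr1, mul_one] at hcap
    rw [expect_pairChannel_eq hφ G, Complex.ofReal_re, re_expect_pairField_sWave_liebVec_eq m]
    -- bookkeeping
    have hm0 : (0 : ℝ) ≤ m := Nat.cast_nonneg m
    have hL4 : ((m : ℝ) + 1) * ((L : ℝ) ^ 2 - m) ≤ (L : ℝ) ^ 4 := by
      nlinarith [mul_nonneg (sub_nonneg.2 hmL) (sq_nonneg (L : ℝ)),
        mul_nonneg hm0 (by positivity : (0 : ℝ) ≤ m + 1)]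
    have hQ0 : 0 ≤ ∑ γ : Config (FermionTorus 2 L) m, ∑ δ : Config (FermionTorus 2 L) m,
        ‖(∑ y : FermionTorus 2 L,
              ((annihilation y).submatrix
                  (Subtype.val : Config (FermionTorus 2 L) m → Finset (FermionTorus 2 L))
                  (Subtype.val : Config (FermionTorus 2 L) (m + 1) → Finset (FermionTorus 2 L))) * CFC.abs (liebW (m + 1) φ) * (
              ((annihilation y).submatrix
                  (Subtype.val : Config (FermionTorus 2 L) m → Finset (FermionTorus 2 L))
                  (Subtype.val : Config (FermionTorus 2 L) (m + 1) → Finset (FermionTorus 2 L))))ᵀ) γ δ‖ ^ 2 := by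
      positivity
    exact sq_le_one_mul_mul_two_mul hblock hcap hL4 hQ0

end Torus

end Summit.HubbardSuperconductivity.HubbardSuperconductivity.Theorems.LiebTwinMajorant

end
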